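import Summits.ResolutionOfSingularities.ResolutionOfSingularities.Theorems.MarkedTransferCampaignW13RFlatArcCriterion
import Mathlib.Algebra.CharP.Lemmas
import HarnessLib

/-!
# [OURS · L1 W1.3] Scaled-Taylor form of the arc criterion for `℘_alg(((g), b), 1)` and an Euler-operator certificate for
# `q`-power-free supports (seat res-L1-s13-pv-1, g3)

LADDER-RESOLUTION rung L (rescue), cell `res-hironaka`, RESCUE-SEED slot W1.3 (architecture bypass, reading R-flat), F7′ row 1.
Two generic tools, used by the companion file `MarkedTransferCampaignW13RFlatCanonicalPosSurfaceAllP.lean` (the rung-1 R-flat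
failure on `𝒞_can` for SURFACES in EVERY characteristic):

* **Scaled Taylor certificate** (`pow_dvd_aeval_hasseDeriv_of_scaled_taylor`, `not_mem_pAlgPiece_one_of_scaled_taylor`).
  p506602's arc criterion `W13.not_mem_pAlgPiece_one_of_arc_general` asks for `θ^{b−|α|} ∣ φ(D^{(α)} g)` for every Hasse
  multi-index `|α| < b` along the arc `φ = aeval γ : K[x_σ] → K[t]`. Since `φ(D^{(α)}g)` is the `v^α`-coefficient of
  `g(γ + v)` (p506602 `aeval_hasseDeriv_eq_coeff_taylor`) and rescaling `v ↦ θ·v` multiplies that coefficient by `θ^{|α|}`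
  (`coeff_aeval_C_mul_X`), ALL these divisibilities follow from ONE divisibility in `K[t][v_σ]`:
  `C(θ^b) ∣ g(γ + θ·v)`. This is the form in which a uniform-in-`p` certificate can be written by ring algebra.
* **Euler certificate** (`coeff_X_mul_pderiv`, `exists_not_dvd_of_eq_euler`): `coeff_m (x_i·∂_i A) = m_i · coeff_m A`, so in
  characteristic `q` every monomial of `x_i·∂_i A + x_j·∂_j B` has its `i`-th or `j`-th exponent NOT divisible by `q` — the
  support condition of o2's `Campaign.IsCanonicalChain` (p483384) for a knock-out written as `x·∂_x A + y·∂_y B`.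

Elementary commutative algebra ([folklore]); nothing here is a statement of H. Hironaka's manuscript [Hironaka2017]
(2017-03-23, lit key `paper:url-3343fd9e678b`), nothing here is progress on resolution of singularities in positive
characteristic; OURS tooling for OURS objects (bound algebraic `℘`, row 003 U17_2). AI bookkeeping weaker than expert review.
-/

noncomputable section

set_option linter.dupNamespace false -- mandated namespace of this single-conjunct summit

namespace Summit.ResolutionOfSingularities.ResolutionOfSingularities.Theorems.Campaign.W13

open MvPolynomial
open Literature.AlgebraicGeometry.Resolution

universe u

/-! ## §1 Rescaling the Taylor increment -/

section Rescale

variable {R : Type*} [CommSemiring R] {τ : Type*}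

/-- For a monomial: substituting `x_i ↦ c·x_i` multiplies `monomial β a` by `c^{|β|}`. [folklore] -/
theorem aeval_C_mul_X_monomial (c : R) (β : τ →₀ ℕ) (a : R) :
    aeval (fun i => C c * X i) (monomial β a) = monomial β (c ^ β.degree * a) := by
  classical
  rw [aeval_monomial, Finsupp.prod]
  have h : ∏ i ∈ β.support, (C c * X i : MvPolynomial τ R) ^ β i =
      C (c ^ β.degree) * ∏ i ∈ β.support, (X i : MvPolynomial τ R) ^ β i := by
    simp_rw [mul_pow]
    rw [Finset.prod_mul_distrib, Finset.prod_pow_eq_pow_sum, ← map_pow, Finsupp.degree_apply]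
  rw [h, prod_X_pow_eq_monomial, algebraMap_eq, C_mul_monomial, C_mul_monomial, mul_one, mul_comm]

/-- **Rescaling the increment multiplies Taylor coefficients by powers**: `coeff_α F(c·v) = c^{|α|}·coeff_α F(v)`.
[folklore] -/
theorem coeff_aeval_C_mul_X (c : R) (F : MvPolynomial τ R) (α : τ →₀ ℕ) :
    coeff α (aeval (fun i => C c * X i) F) = c ^ α.degree * coeff α F := by
  classical
  induction F using MvPolynomial.induction_on' with
  | monomial β a =>
    rw [aeval_C_mul_X_monomial, coeff_monomial, coeff_monomial]
    split_ifs with h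
    · rw [h]
    · rw [mul_zero]
  | add p q hp hq => rw [map_add, coeff_add, coeff_add, hp, hq, mul_add]

end Rescale

/-! ## §2 The scaled Taylor certificate -/

section ScaledTaylor

variable (K : Type u) [Field K] {σ : Type} [Fintype σ] [DecidableEq σ]

omit [Fintype σ] [DecidableEq σ] in
/-- The scaled Taylor substitution `x_i ↦ γ_i + θ·v_i` is the plain one `x_i ↦ γ_i + v_i` followed by the rescaling
`v_i ↦ θ·v_i`. [folklore] -/
theorem aeval_scaled_eq (γ : σ → Polynomial K) (θ : Polynomial K) (g : MvPolynomial σ K) :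
    MvPolynomial.aeval (R := K)
        (fun i => (MvPolynomial.C (γ i) : MvPolynomial σ (Polynomial K)) + MvPolynomial.C θ * X i) g =
      MvPolynomial.aeval (fun i => (MvPolynomial.C θ : MvPolynomial σ (Polynomial K)) * X i)
        (MvPolynomial.aeval (R := K)
          (fun i => (MvPolynomial.C (γ i) : MvPolynomial σ (Polynomial K)) + X i) g) := by
  let S : MvPolynomial σ (Polynomial K) →ₐ[K] MvPolynomial σ (Polynomial K) :=
    (MvPolynomial.aeval (fun i => (MvPolynomial.C θ : MvPolynomial σ (Polynomial K)) * X i)).restrictScalars K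
  have h := MvPolynomial.comp_aeval_apply
    (f := fun i => (MvPolynomial.C (γ i) : MvPolynomial σ (Polynomial K)) + X i) S g
  have hS : (fun i => S ((MvPolynomial.C (γ i) : MvPolynomial σ (Polynomial K)) + X i)) =
      fun i => MvPolynomial.C (γ i) + MvPolynomial.C θ * X i := by
    funext i
    simp [S, MvPolynomial.algebraMap_eq]
  rw [hS] at h
  rw [← h]
  rfl

omit [Fintype σ] [DecidableEq σ] in
/-- **Scaled Taylor certificate ⇒ Hasse–Schmidt divisibilities.** If `C(θ^b)` divides `g(γ + θ·v)` in `K[t][v_σ]` and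
`θ ≠ 0`, then `θ^{b−|α|} ∣ φ(D^{(α)}g)` for every `|α| < b`, `φ = aeval γ` — exactly hypothesis `hd` of p506602
`not_mem_pAlgPiece_one_of_arc_general`. Proof: the `v^α`-coefficient of `g(γ+θv)` is `θ^{|α|}·φ(D^{(α)}g)`
(`aeval_hasseDeriv_eq_coeff_taylor`, `coeff_aeval_C_mul_X`) and also `θ^b·coeff_α H`; cancel `θ^{|α|}` in the domain `K[t]`.
[folklore] -/
theorem pow_dvd_aeval_hasseDeriv_of_scaled_taylor (γ : σ → Polynomial K) {θ : Polynomial K} (hθ : θ ≠ 0)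
    (g : MvPolynomial σ K) (b : ℕ)
    (hH : (MvPolynomial.C (θ ^ b) : MvPolynomial σ (Polynomial K)) ∣
      MvPolynomial.aeval (R := K)
        (fun i => (MvPolynomial.C (γ i) : MvPolynomial σ (Polynomial K)) + MvPolynomial.C θ * X i) g) :
    ∀ α : σ →₀ ℕ, α.degree < b → θ ^ (b - α.degree) ∣ MvPolynomial.aeval γ (hasseDeriv K α g) := by
  intro α hα
  obtain ⟨H, hH⟩ := hH
  have key : θ ^ α.degree * MvPolynomial.aeval γ (hasseDeriv K α g) = θ ^ b * coeff α H := by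
    rw [aeval_hasseDeriv_eq_coeff_taylor, ← coeff_aeval_C_mul_X, ← aeval_scaled_eq, hH, coeff_C_mul]
  refine ⟨coeff α H, mul_left_cancel₀ (pow_ne_zero α.degree hθ) ?_⟩
  rw [key, ← mul_assoc, ← pow_add, Nat.add_sub_cancel' hα.le]

/-- **Arc criterion, scaled-Taylor form** (NEG certificate for `℘_alg(((g),b),1)`): `θ ≠ 0`, `C(θ^b) ∣ g(γ + θ·v)` in
`K[t][v]`, and `θ ∤ φ(c)` imply `c ∉ ℘_alg(((g),b),1)` (p506602 `not_mem_pAlgPiece_one_of_arc_general`, bound algebraic `℘`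
of row 003 U17_2). [folklore] -/
theorem not_mem_pAlgPiece_one_of_scaled_taylor (γ : σ → Polynomial K) {θ : Polynomial K} (hθ : θ ≠ 0)
    (g : MvPolynomial σ K) (b : ℕ)
    (hH : (MvPolynomial.C (θ ^ b) : MvPolynomial σ (Polynomial K)) ∣
      MvPolynomial.aeval (R := K)
        (fun i => (MvPolynomial.C (γ i) : MvPolynomial σ (Polynomial K)) + MvPolynomial.C θ * X i) g)
    {c : MvPolynomial σ K} (hc : ¬ θ ∣ MvPolynomial.aeval γ c) :
    c ∉ Campaign.pAlgPiece K (Ideal.span {g}) b 1 :=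
  not_mem_pAlgPiece_one_of_arc_general K (MvPolynomial.aeval γ).toRingHom hθ g b
    (pow_dvd_aeval_hasseDeriv_of_scaled_taylor K γ hθ g b hH) hc

end ScaledTaylor

/-! ## §3 The Euler-operator certificate for `q`-power-free supports -/

section Euler

variable {R : Type*} [CommSemiring R] {τ : Type*}

/-- **Euler's identity coefficientwise**: `coeff_m (x_i · ∂_i A) = m_i · coeff_m A`. [folklore] -/
theorem coeff_X_mul_pderiv (i : τ) (A : MvPolynomial τ R) (m : τ →₀ ℕ) :
    coeff m (X i * pderiv i A) = (m i : R) * coeff m A := by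
  classical
  induction A using MvPolynomial.induction_on' with
  | monomial β a =>
    rw [pderiv_monomial, X, monomial_mul, one_mul, coeff_monomial, coeff_monomial]
    by_cases hβ : β i = 0
    · have l : (if Finsupp.single i 1 + (β - Finsupp.single i 1) = m then a * ((β i : ℕ) : R) else 0) = 0 := by
        rw [hβ, Nat.cast_zero, mul_zero, ite_self]
      rw [l]
      split_ifs with h
      · rw [← h, hβ, Nat.cast_zero, zero_mul]
      · rw [mul_zero]
    · have hs : Finsupp.single i 1 + (β - Finsupp.single i 1) = β := by
        rw [add_comm]
        exact tsub_add_cancel_of_le (Finsupp.single_le_iff.mpr (Nat.one_le_iff_ne_zero.mpr hβ))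
      rw [hs]
      split_ifs with h
      · rw [← h, mul_comm]
      · rw [mul_zero]
  | add p q hp hq => rw [map_add, mul_add, coeff_add, coeff_add, hp, hq, mul_add]

/-- In characteristic `q`: a monomial of `x_i · ∂_i A` has `i`-th exponent NOT divisible by `q`. [folklore] -/
theorem not_dvd_of_mem_support_X_mul_pderiv (q : ℕ) [CharP R q] (i : τ) (A : MvPolynomial τ R) {m : τ →₀ ℕ}
    (hm : m ∈ (X i * pderiv i A).support) : ¬ q ∣ m i := by
  intro h
  rw [mem_support_iff, coeff_X_mul_pderiv, (CharP.cast_eq_zero_iff R q (m i)).mpr h, zero_mul] at hm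
  exact hm rfl

/-- **Euler certificate for `q`-power-freeness**: if `f = x_i·∂_i A + x_j·∂_j B` in characteristic `q`, then every monomial
of `f` has an exponent not divisible by `q` (the support condition of `Campaign.IsCanonicalChain`, p483384). [folklore] -/
theorem exists_not_dvd_of_eq_euler (q : ℕ) [CharP R q] (i j : τ) {f : MvPolynomial τ R} (A B : MvPolynomial τ R)
    (h : f = X i * pderiv i A + X j * pderiv j B) : ∀ m ∈ f.support, ∃ l, ¬ q ∣ m l := by
  classical
  intro m hm
  rw [h] at hm
  rcases Finset.mem_union.mp (support_add hm) with h1 | h2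
  · exact ⟨i, not_dvd_of_mem_support_X_mul_pderiv q i A h1⟩
  · exact ⟨j, not_dvd_of_mem_support_X_mul_pderiv q j B h2⟩

end Euler

/-! ## §4 A binomial remainder -/

section Binomial

variable {R : Type*} [CommRing R]

/-- `(a + h)^{n+1} = a^{n+1} + (n+1)·a^n·h + h²·r` for some `r`. [folklore] -/
theorem exists_add_pow_succ_eq (a h : R) (n : ℕ) :
    ∃ r : R, (a + h) ^ (n + 1) = a ^ (n + 1) + ((n + 1 : ℕ) : R) * a ^ n * h + h ^ 2 * r := by
  induction n with
  | zero => exact ⟨0, by push_cast; ring⟩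
  | succ n ih =>
    obtain ⟨r, hr⟩ := ih
    refine ⟨(a + h) * r + ((n + 1 : ℕ) : R) * a ^ n, ?_⟩
    rw [pow_succ, hr]
    push_cast
    ring

end Binomial

end Summit.ResolutionOfSingularities.ResolutionOfSingularities.Theorems.Campaign.W13

end
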